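import Mathlib
import HarnessLib
import Literature.MathematicalPhysics.QuantumFieldTheory.ConstructiveQFTWave0
import Summits.Ventures.LatticeQCDFlow.Scaling.TunnellingLaws
import Summits.Ventures.LatticeQCDFlow.Scaling.FluxPatch
import Summits.Ventures.LatticeQCDFlow.Scaling.FluxSmallSteps
import Summits.Ventures.LatticeQCDFlow.Scaling.FluxTunnelling

/-!
# LatticeQCDFlow / Scaling — barrier supplement v3.0: THE LOCAL-MOVE TUNNELLING LAW (topological freezing is a theorem about exact local samplers)

HONEST FRAMING: exact (Metropolis-corrected) sampling algorithms for lattice gauge theory;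
figures of merit are autocorrelation/cost numbers at stated couplings and volumes; no
continuum-physics claim.

THEORY-2.md §5.12 (theory seat GEN-17).  One PROVED supplement to `TopologicalModeCollapse`
(`Scaling/Barriers.lean`, (B2)) and `VolumeScalingOfTraining` (B1), in the barrier-docstring format
(`technique_class` · `blocks` · `because` · `evasions_known` · `scope_caveats` · `nearest_prior_art` ·
`status`): a `def … : Prop` immediately DISCHARGED by `Scaling/TunnellingLaws.lean` (abstract engine) and
`Scaling/FluxPatch.lean`, `Scaling/FluxSmallSteps.lean` (the `U(1)` flux-sector separating sets) and `Scaling/FluxTunnelling.lean` (the laws).  `TopologicalModeCollapse` prices the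
flow side of topological freezing (a model that under-covers a sector makes the exact chain slow); this
supplement prices the OTHER side — the local and small-step exact samplers that flows are meant to beat, and
the local / sub-volume flow proposals offered as evasions of (B1) — by one inequality: stationary charge-change
probability per step `≤ 2 ×` equilibrium mass of an explicit separating set.  The barrier NAMES of record
(VolumeScalingOfTraining, TopologicalModeCollapse, ExactnessVsExpressivity, FermionDeterminantCost) are
unchanged; the literature under `nearest_prior_art` is CONTEXT found by search (THEORY-2.md §8 (43)),
nothing is imported from it.
-/

noncomputable section

namespace Summit.Ventures.LatticeQCDFlow.Barriers

open MeasureTheory ProbabilityTheory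
open scoped ENNReal
open Literature.MathematicalPhysics.QuantumFieldTheory
open Summit.Ventures.LatticeQCDFlow.Theory2.Lattice.Flux (topCharge planeCollar planeSite patchAction plaqLinks)

/-- **Supplement (LocalMoveTunnellingLaw) to TopologicalModeCollapse / VolumeScalingOfTraining — EXACTNESS ×
MOVE-LOCALITY PRICES EVERY SECTOR CHANGE IN EQUILIBRIUM MASS OF A SEPARATING SET.**
(ABSTRACT) For every measurable space `X`, charge `Q : X → ι`, move relation `R` and set `B` that SEPARATES
`Q` along `R` (every `R`-move changing `Q` starts or ends in `B`), every s-finite `μ` and every `μ`-INVARIANT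
Markov kernel `κ` whose moves are `μ ⊗ κ`-a.s. in `R`: `(μ ⊗ κ){Q ≠ Q'} ≤ 2·μ(B)`.
(`U(1)` FLUX SECTORS, every `d`, every `L ≥ 1`, compact `U(1) = Circle`, geometric charge
`Q = Φ_{μν}(x₀)/2π ∈ ℤ` of a lattice plane, NO hypothesis on the measure `m` beyond `κ`-invariance)
(SMALL STEPS) if `κ` moves configurations by `≤ ρ` in the sup-chordal metric a.s., then
`(m ⊗ κ){Q ≠ Q'} ≤ 2·m(planeCollar 4ρ)` (some plane plaquette within chordal distance `4ρ` of `-1`;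
`≤ 2·L²·max_p m{‖u_p + 1‖ ≤ 4ρ}` by the union bound `Flux.measure_planeCollar_le`);
(LOCAL PATCHES) if `κ` leaves the plane plaquettes outside a non-empty patch `P` of `m = #P` positions unchanged
a.s. (single-link / multi-link heat bath or Metropolis, masked or domain-decomposed flow proposals with frozen
boundary, any sub-volume update), then `(m ⊗ κ){Q ≠ Q'} ≤ 2·m{S_P ≥ m(1 - cos(π/m))}`, `S_P = Σ_{p∈P}(1 - Re u_p)`
the `β = 1` Wilson action of the patch (threshold `2` for `m ≤ 2`, `∼ π²/2m` for large `m`; SHARP);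
(LINKS) the same for any update of a finite link set `Λ` with the other links a.s. fixed, `P ⊇` the plane
positions whose plaquette touches `Λ` (`#Λ = 1`, `#P = 2`, threshold `S_P ≥ 2` for one link in `d = 2`);
(`n` STEPS) for any process with all marginals `m` and `ρ`-small consecutive steps,
`P{Q(Z_n) ≠ Q(Z_0)} ≤ n·2·m(planeCollar 4ρ)` — hence (THEORY-2.md §3.3, `Tunnelling.sectorAutocov_ge`) the sector
indicator autocorrelation at lag `n` is `≥ 1 - 2n·m(B)/(a(1-a))` and `τ_int(1_{Q∈S}) ≳ a(1-a)/(8·m(B))`.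
technique_class: EXACT samplers (any `μ_{Λ,β}`-invariant kernel: Metropolis, heat bath, HMC / Langevin /
  ODE-flow steps, flow proposals followed by accept/reject) whose individual MOVES are LOCAL — small in every
  link (`≤ ρ`), or supported on a sub-volume (links `Λ`, plane patch `P(Λ)`), or a composition of such steps
  counted per step — judged by the stationary rate of change of a quantised charge.
blocks: "a local or sub-volume flow proposal (domain decomposition, masked coupling layers updating a block with
  frozen exterior, multilevel / hierarchical block updates) evades `VolumeScalingOfTraining` at no cost in
  topology" — per step it tunnels at most `2·m{S_{P} ≥ #P(1-cos(π/#P))}`, a quantity fixed by the TARGET, not by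
  the model, and exponentially small in `β` for bounded patches (`≍ e^{-2β}` for one link in `d = 2`);
  "small-step exact dynamics (fine leapfrog, Langevin, continuous flows used as MCMC moves) can be tuned to
  change sector" — per step they pay `2·m(planeCollar 4ρ) ≤ 2L²·(one-plaquette cut tail at 4ρ)`; and any
  "topology unfrozen" claim for such an update class at `β` where these masses are below the inverse run
  length.  It does NOT block GLOBAL proposals (all links moved by `O(1)` at once): that is the recorded evasion
  and the reason flow-based global proposals [cite: KanwarEtAl2020, p.5: `τ_int(Q) ≈ 15000` (HMC), `≈ 4000`
  (heat bath), `≈ 10` (flow), 2-d `U(1)`, `L = 16`, `β = 7`] are pursued.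
because: PROVED `Theory2.Tunnelling.compProd_chargeChange_le_of_invariant` (+ `…_le_add_of_invariant` with an
  exceptional set, `measure_chargeChange_le_nsteps`, `sectorReturn_ge`, `sectorAutocov_ge`, finite-state
  `tunnelRate_le` over `Literature.Probability.MarkovChains.IsStationary`) — `{Q(Y) ≠ Q(Z)} ⊆ {Y ∈ B} ∪ {Z ∈ B}`
  a.s., and BOTH marginals of `μ ⊗ κ` are `μ` when `κ` is `μ`-invariant (`Measure.fst_compProd`,
  `Measure.snd_compProd`, `Kernel.Invariant`); the separating sets PROVED in `Scaling/FluxSmallSteps.lean` / `Scaling/FluxPatch.lean`: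
  `Flux.mem_planeCollar_of_dist_le_of_topCharge_ne` (along the linkwise geodesic path each plane plaquette moves
  by at most its four link displacements `≤ 4ρ`, `Flux.dist_plaquetteHolonomy_anglePath_le`, so it never meets
  `-1` and the integer-valued continuous charge is constant, `Flux.topCharge_comp_eq_of_preconnected_plane`) and
  `Flux.patchAction_ge_sharp_or_of_topCharge_ne` (`Φ - Φ' = Σ_P (F_p - F'_p) ∈ 2πℤ∖{0}` forces `Σ_P|F_p| ≥ π` for
  `U` or `U'`, `Flux.pi_le_sum_abs_or_of_topCharge_ne`; then the sharp cosine budget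
  `Σ_P(1 - cos F_p) ≥ m(1 - cos(π/m))`, `Theory2.Trig.card_mul_one_sub_cos_le_sum` of `Scaling/CosineBudget.lean`,
  tangent line at `π/m`); assembled in `Scaling/FluxTunnelling.lean` as
  `Flux.compProd_topCharge_ne_le_of_dist_le`, `Flux.compProd_topCharge_ne_le_of_patch_sharp`,
  `Flux.compProd_topCharge_ne_le_of_links_sharp` (plaquettes not touching `Λ` are unchanged,
  `Flux.plaquette_eq_off_patch_of_links`), `Flux.measure_topCharge_ne_le_nsteps_of_dist_le`.
evasions_known: (i) GLOBAL proposals — a flow proposal moving every link by `O(1)` is in no `R` above (the class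
  the venture builds; its price is `TopologicalModeCollapse` / `ExactnessVsExpressivity`, not this law);
  (ii) change the TARGET so the separating set is not rare: open boundary conditions in one direction
  [cite: LuscherSchaefer2011] (no quantised charge), tempering in `β` or in a boundary defect (parallel
  tempering / PTBC), OBC-defect priors evolved to PBC [cite: BonannoEtAl2026, §5], multicanonical / metadynamics
  reweighting of `m` (the law then holds for the modified `m`, whose collar mass is large by design, and the
  cost moves to reweighting); (iii) very long trajectories counted as ONE step (HMC with `τ ≫ 1`: the law prices
  the `n = τ/δτ` fine steps through the `n`-step version only if the intermediate fields are `m`-distributed,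
  which holds for exact integration / SMD and approximately for leapfrog [cite: Luscher2010WilsonFlow, p.7]);
  (iv) non-compact or Lie-algebra-valued reformulations in which `Q` is not quantised.
scope_caveats: compact `U(1)` only as typed (the `SU(N)` analogue needs a quantised lattice charge off a
  collar — [cite: Luscher1982Topology] — and is conjecture C7 of THEORY-2.md, not a theorem of the tree); the law
  bounds the charge-change probability by the mass of the separating set but does NOT estimate that mass: the
  Gibbs tails `m_β{‖u_p + 1‖ ≤ s}`, `m_β{S_P ≥ 2}` enter as hypotheses (`η`, `M` in
  `Flux.compProd_topCharge_ne_le_of_plaquetteTail` / `…_of_patchTail`; for the 2-d Wilson plaquette density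
  `∝ e^{β cos θ}` they are `≍ e^{-2β}·poly(β, s)` — printed / heuristic, not certified); the sup-metric collar
  `4ρ` makes the small-step law vacuous for production leapfrog step sizes (`4ρ = O(1)`); it is informative for
  fine integrators, Langevin / flow ODE steps and through the per-plaquette displacement version
  (`Flux.compProd_topCharge_ne_le_of_plaqDisp_le`); HMC momenta are Gaussian, so the a.s. step bound is replaced
  by the exceptional-set law `≤ 2·m(B) + (m ⊗ κ){step > ρ}`; the factor `2` and one-sidedness (`U` OR `U'` in
  the patch set) are not optimised; a law per `(μ,ν)`-plane and base point `x₀`.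
nearest_prior_art: the bottleneck / conductance inequalities of Markov-chain theory (Cheeger–Jerrum–Sinclair–
  Lawler–Sokal; [cite: LevinPeres2017, Thm 7.4 (bottleneck ratio)], [cite: JerrumSinclair1993]) — this law is their
  one-line stationary form for a charge, with explicit finite-lattice separating sets; the physics heuristic it
  formalises is printed: "it is unlikely that such a trajectory leads from one sector to another, because the
  fields along the trajectories are, to a good approximation, distributed according to their weight"
  [cite: Luscher2010WilsonFlow, pp.6–7, probability of non-admissible fields `O(a^6)`], "`τ_top ∼ exp F_b`, where
  `F_b` is the typical free-energy barrier between different topological sectors" [cite: DeldebbioMancaVicari2004,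
  p.2; fits `τ ∼ exp(c ξ^θ)`, `θ ≈ 0.3`, pp.4–5].  Searched (THEORY-2.md §8 (43), corpus fts+vec and galaxy): no
  printed theorem bounding the per-step tunnelling probability of an arbitrary invariant local kernel by an
  explicit lattice separating set was found; novelty is the typing and the patch/step separating sets, not the
  mechanism.
status: PROVED (`localMoveTunnellingLaw`). -/
def LocalMoveTunnellingLaw : Prop :=
  (∀ (X ι : Type) [MeasurableSpace X] (R : X → X → Prop) (Q : X → ι) (B : Set X),
    (∀ ⦃x y⦄, R x y → Q x ≠ Q y → x ∈ B ∨ y ∈ B) →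
    ∀ (μ : Measure X) [SFinite μ] (κ : Kernel X X) [IsMarkovKernel κ], κ.Invariant μ →
    (∀ᵐ p ∂(μ ⊗ₘ κ), R p.1 p.2) → (μ ⊗ₘ κ) {p | Q p.1 ≠ Q p.2} ≤ 2 * μ B) ∧
  (∀ (d L : ℕ) [NeZero L] (x₀ : Site d L) (μ ν : Fin d) (m : Measure (GaugeConfig d L Circle)) [SFinite m]
    (κ : Kernel (GaugeConfig d L Circle) (GaugeConfig d L Circle)) [IsMarkovKernel κ] (ρ : ℝ),
    κ.Invariant m → (∀ᵐ q ∂(m ⊗ₘ κ), dist q.1 q.2 ≤ ρ) →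
    (m ⊗ₘ κ) {q | topCharge x₀ μ ν q.1 ≠ topCharge x₀ μ ν q.2} ≤ 2 * m (planeCollar x₀ μ ν (4 * ρ))) ∧
  (∀ (d L : ℕ) [NeZero L] (x₀ : Site d L) (μ ν : Fin d) (P : Finset (ZMod L × ZMod L)), P.Nonempty →
    ∀ (m : Measure (GaugeConfig d L Circle)) [SFinite m]
    (κ : Kernel (GaugeConfig d L Circle) (GaugeConfig d L Circle)) [IsMarkovKernel κ], κ.Invariant m →
    (∀ᵐ q ∂(m ⊗ₘ κ), ∀ p ∉ P, plaquetteHolonomy q.1 (planeSite x₀ μ ν p) μ ν =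
      plaquetteHolonomy q.2 (planeSite x₀ μ ν p) μ ν) →
    (m ⊗ₘ κ) {q | topCharge x₀ μ ν q.1 ≠ topCharge x₀ μ ν q.2} ≤
      2 * m {U | (P.card : ℝ) * (1 - Real.cos (Real.pi / P.card)) ≤ patchAction x₀ μ ν P U}) ∧
  (∀ (d L : ℕ) [NeZero L] (x₀ : Site d L) (μ ν : Fin d) (Λ : Finset (Edge d L))
    (P : Finset (ZMod L × ZMod L)), P.Nonempty →
    (∀ p, (∃ e ∈ plaqLinks (planeSite x₀ μ ν p) μ ν, e ∈ Λ) → p ∈ P) →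
    ∀ (m : Measure (GaugeConfig d L Circle)) [SFinite m]
    (κ : Kernel (GaugeConfig d L Circle) (GaugeConfig d L Circle)) [IsMarkovKernel κ], κ.Invariant m →
    (∀ᵐ q ∂(m ⊗ₘ κ), ∀ e ∉ Λ, q.1 e = q.2 e) →
    (m ⊗ₘ κ) {q | topCharge x₀ μ ν q.1 ≠ topCharge x₀ μ ν q.2} ≤
      2 * m {U | (P.card : ℝ) * (1 - Real.cos (Real.pi / P.card)) ≤ patchAction x₀ μ ν P U}) ∧
  (∀ (d L : ℕ) [NeZero L] (x₀ : Site d L) (μ ν : Fin d) (Ω : Type) [MeasurableSpace Ω] (P : Measure Ω)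
    (Z : ℕ → Ω → GaugeConfig d L Circle), (∀ k, Measurable (Z k)) →
    ∀ (m : Measure (GaugeConfig d L Circle)), (∀ k, P.map (Z k) = m) → ∀ (ρ : ℝ),
    (∀ k, ∀ᵐ ω ∂P, dist (Z k ω) (Z (k + 1) ω) ≤ ρ) → ∀ n : ℕ,
    P {ω | topCharge x₀ μ ν (Z n ω) ≠ topCharge x₀ μ ν (Z 0 ω)} ≤ n * (2 * m (planeCollar x₀ μ ν (4 * ρ))))

/-- Discharge of `LocalMoveTunnellingLaw` by `Scaling/TunnellingLaws.lean` and `Scaling/FluxTunnelling.lean`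
(with `Scaling/FluxPatch.lean`, `Scaling/FluxSmallSteps.lean`, `Scaling/CosineBudget.lean`). -/
theorem localMoveTunnellingLaw : LocalMoveTunnellingLaw :=
  ⟨fun _ _ _ _ _ _ hB μ _ κ _ hinv hR => Theory2.Tunnelling.compProd_chargeChange_le_of_invariant hB μ κ hinv hR,
    fun _ _ _ x₀ μ ν m _ κ _ _ hinv hstep =>
      Theory2.Lattice.Flux.compProd_topCharge_ne_le_of_dist_le x₀ μ ν m κ hinv hstep,
    fun _ _ _ x₀ μ ν _ hP m _ κ _ hinv hloc =>
      Theory2.Lattice.Flux.compProd_topCharge_ne_le_of_patch_sharp x₀ μ ν hP m κ hinv hloc,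
    fun _ _ _ x₀ μ ν Λ _ hPne hP m _ κ _ hinv hloc =>
      Theory2.Lattice.Flux.compProd_topCharge_ne_le_of_links_sharp x₀ μ ν Λ hPne hP m κ hinv hloc,
    fun _ _ _ x₀ μ ν _ _ P Z hZ m hmarg _ hstep n =>
      Theory2.Lattice.Flux.measure_topCharge_ne_le_nsteps_of_dist_le x₀ μ ν P Z hZ m hmarg hstep n⟩

/-- **Reading for the heat bath** (THEORY-2.md §3.3): a single-link update in `d = 2` changes the `#P = 2`
plane plaquettes containing the link, and `2·(1 - cos(π/2)) = 2`, so its stationary tunnelling probability is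
`≤ 2·m{S_P ≥ 2}` — both plaquettes at the link must be simultaneously near `-1`. [folklore] -/
theorem two_mul_one_sub_cos_pi_div_two : (2 : ℝ) * (1 - Real.cos (Real.pi / 2)) = 2 := by
  rw [Real.cos_pi_div_two]; ring

end Summit.Ventures.LatticeQCDFlow.Barriers
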